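import Mathlib.Analysis.SpecialFunctions.PolarCoord
import Mathlib.Analysis.SpecialFunctions.Integrability.Basic
import Mathlib.MeasureTheory.Measure.Lebesgue.VolumeOfBalls
import Literature.MeasureTheory.Hausdorff.EnergyMethod
import HarnessLib

/-!
# Planar Lebesgue measure has finite Riesz `β`-energy on bounded sets for `β < 2`

Topic: measure theory / Hausdorff dimension (energy method). For the Riesz kernel
`k_β(x, y) = |x - y|^{-β}` of `Literature/MeasureTheory/Hausdorff/EnergyMethod.lean` and the
Lebesgue measure of the plane `ℂ`:

* `lintegral_closedBall_enorm_inv_rpow_lt_top` — `∫_{|z| ≤ D} |z|^{-β} dz < ∞` for `0 ≤ β < 2`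
  (polar coordinates, Mathlib `Complex.lintegral_comp_polarCoord_symm`: the integral is at most
  `2π ∫₀^D r^{1-β} dr`, finite by `intervalIntegral.integrableOn_Ioo_rpow_iff`);
* `rieszEnergy_volume_restrict_ne_top` — for a bounded measurable `K ⊆ ℂ` and `0 ≤ β < 2`,
  `I_β(vol|_K) = ∫_K ∫_K |x - y|^{-β} dx dy < ∞` (translation invariance of the Lebesgue measure
  reduces the inner integral to the previous one).

This is the hypothesis "the reference measure has finite `β`-energy for `β < d`" (`d = 2`) of
the second moment method for random planar fractals
(`Literature/Probability/RandomFractals/SecondMomentDimension.lean`, Beffara's Proposition 1 (2)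
for subsets of the unit square), i.e. the classical fact that `∫∫_{[0,1]²×[0,1]²} |x-y|^{-β} < ∞`
iff `β < 2`. All proved; Mathlib-only imports besides `EnergyMethod.lean`.

## Mathlib

We USE `Complex.lintegral_comp_polarCoord_symm`, `Complex.norm_polarCoord_symm`,
`intervalIntegral.integrableOn_Ioo_rpow_iff`, `lintegral_prod_mul`, `Measure.prod_restrict`,
`lintegral_sub_right_eq_self` (translation invariance), `Bornology.IsBounded.measure_lt_top`.

## References

* P. Mattila, *Geometry of Sets and Measures in Euclidean Spaces*, CUP (1995), Ch. 8 (Riesz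
  energies of Lebesgue measure, (8.2)).
* V. Beffara, *The dimension of the SLE curves*, Ann. Probab. 36 (2008), §1 (Prop. 1 on the
  unit square, `d = 2`).
-/

noncomputable section

open Set Filter Function Metric Real
open _root_.MeasureTheory _root_.MeasureTheory.Measure
open Literature.MeasureTheory.Hausdorff
open scoped ENNReal NNReal Topology

namespace Literature.MeasureTheory.Hausdorff

/-- The radial integral `∫_{(0, D]} r^{1-β} dr` is finite for `β < 2` (as a lower Lebesgue
integral of `ofReal`). [folklore] -/
theorem lintegral_Ioc_rpow_one_sub_lt_top {β : ℝ} (hβ : β < 2) {D : ℝ} (hD : 0 < D) :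
    ∫⁻ r in Ioc 0 D, ENNReal.ofReal (r ^ (1 - β)) < ⊤ := by
  have hint : IntegrableOn (fun r : ℝ ↦ r ^ (1 - β)) (Ioo 0 D) :=
    (intervalIntegral.integrableOn_Ioo_rpow_iff hD).2 (by linarith)
  have hint' : IntegrableOn (fun r : ℝ ↦ r ^ (1 - β)) (Ioc 0 D) :=
    hint.congr_set_ae Ioo_ae_eq_Ioc.symm
  have h := hint'.hasFiniteIntegral
  rw [hasFiniteIntegral_iff_enorm] at h
  refine lt_of_le_of_lt (setLIntegral_mono' measurableSet_Ioc fun r hr ↦ ?_) h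
  rw [Real.enorm_eq_ofReal (rpow_nonneg hr.1.le _)]

/-- The real identity `r · (r⁻¹)^β = r^{1-β}` (`r > 0`). [folklore] -/
theorem mul_inv_rpow_eq_rpow_one_sub {r : ℝ} (hr : 0 < r) (β : ℝ) : r * r⁻¹ ^ β = r ^ (1 - β) := by
  rw [Real.inv_rpow hr.le, ← Real.rpow_neg hr.le, sub_eq_add_neg, Real.rpow_add hr, Real.rpow_one]

/-- **The planar Riesz integral over a disc is finite**: `∫_{|z| ≤ D} |z|^{-β} dz < ∞` for
`0 ≤ β < 2` (polar coordinates, Mathlib `Complex.lintegral_comp_polarCoord_symm`: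
`≤ 2π ∫₀^D r^{1-β} dr`). [folklore] -/
theorem lintegral_closedBall_enorm_inv_rpow_lt_top {β : ℝ} (hβ0 : 0 ≤ β) (hβ : β < 2) {D : ℝ}
    (hD : 0 < D) :
    ∫⁻ z in closedBall (0 : ℂ) D, (‖z‖ₑ)⁻¹ ^ β < ⊤ := by
  set f : ℂ → ℝ≥0∞ := (closedBall (0 : ℂ) D).indicator fun z ↦ (‖z‖ₑ)⁻¹ ^ β with hf
  have hEq : ∫⁻ z in closedBall (0 : ℂ) D, (‖z‖ₑ)⁻¹ ^ β = ∫⁻ z, f z :=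
    (lintegral_indicator measurableSet_closedBall _).symm
  rw [hEq, ← Complex.lintegral_comp_polarCoord_symm f]
  -- the dominating product integrand
  set S : Set (ℝ × ℝ) := Ioc (0 : ℝ) D ×ˢ Ioo (-π) π with hS
  set g : ℝ × ℝ → ℝ≥0∞ := S.indicator fun p ↦ ENNReal.ofReal (p.1 ^ (1 - β)) with hg
  have hbound : ∀ p ∈ polarCoord.target,
      ENNReal.ofReal p.1 • f (Complex.polarCoord.symm p) ≤ g p := by
    rintro ⟨r, θ⟩ ⟨hr, hθ⟩
    simp only [mem_Ioi] at hr
    have hnorm : ‖Complex.polarCoord.symm (r, θ)‖ = r := by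
      rw [Complex.norm_polarCoord_symm, abs_of_pos hr]
    by_cases hrD : r ≤ D
    · have hmem : Complex.polarCoord.symm (r, θ) ∈ closedBall (0 : ℂ) D := by
        rw [mem_closedBall, dist_zero_right, hnorm]
        exact hrD
      have hS' : ((r, θ) : ℝ × ℝ) ∈ S := ⟨⟨hr, hrD⟩, hθ⟩
      rw [hf, indicator_of_mem hmem, hg, indicator_of_mem hS', smul_eq_mul]
      have hn : ‖Complex.polarCoord.symm (r, θ)‖ₑ = ENNReal.ofReal r := by
        rw [← ofReal_norm, hnorm]
      rw [hn, ← ENNReal.ofReal_inv_of_pos hr, ENNReal.ofReal_rpow_of_nonneg (inv_pos.2 hr).le hβ0,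
        ← ENNReal.ofReal_mul hr.le, mul_inv_rpow_eq_rpow_one_sub hr]
    · have hnot : Complex.polarCoord.symm (r, θ) ∉ closedBall (0 : ℂ) D := by
        rw [mem_closedBall, dist_zero_right, hnorm]
        exact hrD
      rw [hf, indicator_of_notMem hnot, smul_zero]
      exact zero_le
  -- integrate the bound: `∫ g = (∫_{(0,D]} r^{1-β}) · 2π < ∞`
  have hgi : ∫⁻ p, g p = (∫⁻ r in Ioc (0 : ℝ) D, ENNReal.ofReal (r ^ (1 - β))) *
      volume (Ioo (-π) π) := by
    rw [hg, lintegral_indicator (measurableSet_Ioc.prod measurableSet_Ioo),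
      Measure.volume_eq_prod, ← Measure.prod_restrict]
    have h := lintegral_prod_mul (μ := volume.restrict (Ioc (0 : ℝ) D))
      (ν := volume.restrict (Ioo (-π) π)) (f := fun r : ℝ ↦ ENNReal.ofReal (r ^ (1 - β)))
      (g := fun _ : ℝ ↦ (1 : ℝ≥0∞)) (by fun_prop) aemeasurable_const
    simp only [mul_one, lintegral_const, Measure.restrict_apply_univ, one_mul] at h
    exact h
  calc ∫⁻ p in polarCoord.target, ENNReal.ofReal p.1 • f (Complex.polarCoord.symm p)
      ≤ ∫⁻ p in polarCoord.target, g p :=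
        setLIntegral_mono' polarCoord.open_target.measurableSet hbound
    _ ≤ ∫⁻ p, g p := setLIntegral_le_lintegral _ _
    _ < ⊤ := by
        rw [hgi, Real.volume_Ioo]
        exact ENNReal.mul_lt_top (lintegral_Ioc_rpow_one_sub_lt_top hβ hD) ENNReal.ofReal_lt_top

/-- **Planar Lebesgue measure restricted to a bounded set has finite Riesz `β`-energy for
`0 ≤ β < 2`**: `I_β(vol|_K) = ∫_K ∫_K |x - y|^{-β} dx dy ≤ vol(K) · ∫_{|z| ≤ diam} |z|^{-β} dz < ∞`
(translation invariance and `lintegral_closedBall_enorm_inv_rpow_lt_top`). This is the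
hypothesis "`I_β(λ) < ∞` for `β < d = 2`" of the second moment method
(`Literature/Probability/RandomFractals/SecondMomentDimension.lean`) for the Lebesgue measure of
a square or a disc in the plane. [folklore] -/
theorem rieszEnergy_volume_restrict_ne_top {K : Set ℂ} (hKb : Bornology.IsBounded K)
    (hKm : MeasurableSet K) {β : ℝ} (hβ0 : 0 ≤ β) (hβ : β < 2) :
    rieszEnergy β (volume.restrict K) ≠ ⊤ := by
  obtain ⟨R₀, hR₀⟩ := hKb.subset_closedBall 0
  set D : ℝ := 2 * |R₀| + 1 with hDdef
  have hD : 0 < D := by positivity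
  have hsub : ∀ x ∈ K, K ⊆ closedBall x D := by
    intro x hx y hy
    rw [mem_closedBall]
    have hx' := mem_closedBall.1 (hR₀ hx)
    have hy' := mem_closedBall.1 (hR₀ hy)
    calc dist y x ≤ dist y 0 + dist x 0 := dist_triangle_right _ _ _
      _ ≤ R₀ + R₀ := add_le_add hy' hx'
      _ ≤ D := by rw [hDdef]; linarith [le_abs_self R₀]
  set Φ : ℝ≥0∞ := ∫⁻ z in closedBall (0 : ℂ) D, (‖z‖ₑ)⁻¹ ^ β with hΦ
  have hΦtop : Φ < ⊤ := lintegral_closedBall_enorm_inv_rpow_lt_top hβ0 hβ hD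
  have hinner : ∀ x ∈ K, ∫⁻ y in K, rieszKernel β x y ≤ Φ := by
    intro x hx
    calc ∫⁻ y in K, rieszKernel β x y ≤ ∫⁻ y in closedBall x D, rieszKernel β x y :=
          lintegral_mono_set (hsub x hx)
      _ = ∫⁻ y, (closedBall x D).indicator (fun y ↦ rieszKernel β x y) y :=
          (lintegral_indicator measurableSet_closedBall _).symm
      _ = ∫⁻ y, (closedBall (0 : ℂ) D).indicator (fun z ↦ (‖z‖ₑ)⁻¹ ^ β) (y - x) := by
          refine lintegral_congr fun y ↦ ?_
          have hiff : y ∈ closedBall x D ↔ y - x ∈ closedBall (0 : ℂ) D := by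
            rw [mem_closedBall, mem_closedBall, dist_zero_right, dist_eq_norm]
          by_cases hy : y ∈ closedBall x D
          · rw [indicator_of_mem hy, indicator_of_mem (hiff.1 hy), rieszKernel, edist_comm,
              edist_eq_enorm_sub]
          · rw [indicator_of_notMem hy, indicator_of_notMem (fun h ↦ hy (hiff.2 h))]
      _ = ∫⁻ z, (closedBall (0 : ℂ) D).indicator (fun z ↦ (‖z‖ₑ)⁻¹ ^ β) z :=
          lintegral_sub_right_eq_self _ x
      _ = Φ := lintegral_indicator measurableSet_closedBall _
  have hK : volume K < ⊤ := hKb.measure_lt_top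
  refine (lt_of_le_of_lt ?_ (ENNReal.mul_lt_top hΦtop hK)).ne
  calc rieszEnergy β (volume.restrict K) = ∫⁻ x in K, ∫⁻ y in K, rieszKernel β x y := rfl
    _ ≤ ∫⁻ _ in K, Φ := setLIntegral_mono' hKm hinner
    _ = Φ * volume K := setLIntegral_const _ _

end Literature.MeasureTheory.Hausdorff

end
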